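import Summits.NavierStokesRegularity.NavierStokesRegularity.Theorems.FilamentSkeletonRssCoreLinearInvertibilityClassClosureToolsA
import Literature.Analysis.FluidPDE.GaussianVortexKernelRadial
import Literature.Analysis.FluidPDE.GaussianVortexPlanarProofs
import Literature.Analysis.FluidPDE.BiotSavart2DSymmetry
import Literature.Analysis.FluidPDE.PineauVicolWeightedIdentity
import Summits.AnomalousDissipation.AnomalousDissipation.Theorems.MarginalStabilityChainStretchedVortexRowsStubLogPotentialTools

/-!
# Tools for stub `stub_oddSymmetrizerBoundedBelow` (crux `CoreLinearInvertibility`,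
# stmt-NavierStokesRegularity-17973, route `FilamentSkeletonRss`, line `Sketch`) — part C:
# a moment basis of odd Gaussian-class functions, continuity of the potential, weighted Minkowski

* Two odd continuous functions of Gaussian class on `ℝ²`, `e_j(x) = κ⁻¹ x_j e^{−|x|²/4}`
  (`κ = ∫ x₀² e^{−|x|²/4} dx > 0`), with the first-moment matrix `∫ x_i e_j = δ_ij` — used to correct
  the first moments of an odd density before applying the Gallay–Šverák coercivity on
  `𝒳₁ = {∫ ω = 0, ∫ x_j ω = 0}`. The off-diagonal moments vanish and the diagonal ones agree by the
  symmetry `x ↦ x^⊥` (a planar rotation, which preserves Lebesgue measure: tree `exists_planarRotation`).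
* Continuity of the logarithmic potential `ψ_w = N ∗ w` of a compactly supported `C¹` density (tree:
  `contDiff_one_logPotential_of_gaussBound`, after the Gaussian bounds `|w|, ‖Dw‖ ≤ B e^{−|x|²/8}`).
* Weighted `L²` norms `√∫ g a²`: Minkowski (two and three terms, from the weighted Cauchy–Schwarz
  inequality `abs_integral_weight_mul_mul_le`), scaling, and monotonicity in the weight.

References: Th. Gallay, V. Šverák, arXiv:2110.13739, Rem. 2.7 and §4.1 (the moment conditions);
folklore.
-/

set_option linter.dupNamespace false

noncomputable section

namespace Summit.NavierStokesRegularity.NavierStokesRegularity.Theorems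

open Set Function Filter MeasureTheory Topology Metric
open Literature.Analysis.FluidPDE
open Summit.AnomalousDissipation.AnomalousDissipation.Theorems.MarginalStabilityChainStretchedVortexRows

/-- **The rotation `x ↦ x^⊥` preserves Lebesgue measure on `ℝ²`**: `∫ f(x^⊥) dx = ∫ f`. [folklore] -/
theorem arnold_integral_comp_perp (f : EuclideanSpace ℝ (Fin 2) → ℝ) :
    ∫ x, f (perp x) = ∫ x, f x := by
  obtain ⟨R, hR⟩ := exists_planarRotation 0 1 (by norm_num)
  have hRp : ∀ z, R z = perp z := fun z => by rw [hR, zero_smul, one_smul, zero_add]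
  have h := R.measurePreserving.integral_comp R.toHomeomorph.measurableEmbedding f
  simpa only [hRp] using h

/-- `x₀² e^{−|x|²/4}`, `x₀ x₁ e^{−|x|²/4}` and `|x_j| (1+|x|)^k e^{−|x|²/4}`-type functions are
integrable: the generic bound `|p| ≤ (1+|x|)² e^{−|x|²/4}`. [folklore] -/
theorem arnold_integrable_of_le_sq_mul_exp {p : EuclideanSpace ℝ (Fin 2) → ℝ} (hpm : Continuous p)
    (hp : ∀ x, |p x| ≤ (1 + ‖x‖) ^ 2 * Real.exp (-(‖x‖ ^ 2 / 4))) : Integrable p := by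
  refine (PineauVicol2026.integrable_one_add_norm_pow_mul_exp_neg_mul_sq
    (E := EuclideanSpace ℝ (Fin 2)) (c := 1 / 4) (by norm_num) 2).mono' hpm.aestronglyMeasurable
    (Eventually.of_forall fun x => ?_)
  rw [Real.norm_eq_abs]
  convert hp x using 3
  ring

/-- The normalising constant `κ = ∫ x₀² e^{−|x|²/4} dx` is positive. [folklore] -/
theorem arnold_kappa_pos :
    0 < ∫ x : EuclideanSpace ℝ (Fin 2), x 0 ^ 2 * Real.exp (-(‖x‖ ^ 2 / 4)) := by
  have hcont : Continuous fun x : EuclideanSpace ℝ (Fin 2) => x 0 ^ 2 * Real.exp (-(‖x‖ ^ 2 / 4)) := by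
    fun_prop
  have hnn : ∀ x : EuclideanSpace ℝ (Fin 2), 0 ≤ x 0 ^ 2 * Real.exp (-(‖x‖ ^ 2 / 4)) := fun x => by
    positivity
  have hint : Integrable fun x : EuclideanSpace ℝ (Fin 2) => x 0 ^ 2 * Real.exp (-(‖x‖ ^ 2 / 4)) := by
    refine arnold_integrable_of_le_sq_mul_exp hcont fun x => ?_
    rw [abs_of_nonneg (hnn x)]
    have hx0 : |x 0| ≤ ‖x‖ := by simpa using PiLp.norm_apply_le x 0
    have : x 0 ^ 2 ≤ (1 + ‖x‖) ^ 2 := by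
      rw [← sq_abs]; exact pow_le_pow_left₀ (abs_nonneg _) (by linarith) 2
    exact mul_le_mul_of_nonneg_right this (Real.exp_pos _).le
  rw [integral_pos_iff_support_of_nonneg hnn hint]
  have hsupp : Function.support (fun x : EuclideanSpace ℝ (Fin 2) => x 0 ^ 2 * Real.exp (-(‖x‖ ^ 2 / 4))) =
      {x | x 0 ≠ 0} := by
    ext x
    simp [Function.mem_support, (Real.exp_pos _).ne']
  rw [hsupp]
  have hopen : IsOpen {x : EuclideanSpace ℝ (Fin 2) | x 0 ≠ 0} :=
    isOpen_ne.preimage (PiLp.continuous_apply 2 _ 0)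
  refine hopen.measure_pos volume ⟨EuclideanSpace.single 0 1, ?_⟩
  simp

/-- The second moments agree: `∫ x₁² e^{−|x|²/4} = ∫ x₀² e^{−|x|²/4}` (rotate by `x ↦ x^⊥`). [folklore] -/
theorem arnold_integral_sq_one_eq :
    ∫ x : EuclideanSpace ℝ (Fin 2), x 1 ^ 2 * Real.exp (-(‖x‖ ^ 2 / 4)) =
      ∫ x : EuclideanSpace ℝ (Fin 2), x 0 ^ 2 * Real.exp (-(‖x‖ ^ 2 / 4)) := by
  rw [← arnold_integral_comp_perp (fun x => x 1 ^ 2 * Real.exp (-(‖x‖ ^ 2 / 4)))]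
  simp only [perp_apply_one, Literature.Analysis.FluidPDE.norm_perp]

/-- The mixed moment vanishes: `∫ x₀ x₁ e^{−|x|²/4} = 0` (it changes sign under `x ↦ x^⊥`). [folklore] -/
theorem arnold_integral_zero_mul_one_eq_zero :
    ∫ x : EuclideanSpace ℝ (Fin 2), x 0 * x 1 * Real.exp (-(‖x‖ ^ 2 / 4)) = 0 := by
  have h := arnold_integral_comp_perp (fun x => x 0 * x 1 * Real.exp (-(‖x‖ ^ 2 / 4)))
  simp only [perp_apply_zero, perp_apply_one, Literature.Analysis.FluidPDE.norm_perp] at h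
  have h2 : ∫ x : EuclideanSpace ℝ (Fin 2), -x 1 * x 0 * Real.exp (-(‖x‖ ^ 2 / 4)) =
      -∫ x : EuclideanSpace ℝ (Fin 2), x 0 * x 1 * Real.exp (-(‖x‖ ^ 2 / 4)) := by
    rw [← integral_neg]
    exact integral_congr_ae (Eventually.of_forall fun x => by simp only; ring)
  linarith

/-- **A moment basis of odd Gaussian-class functions**: continuous odd `e₀, e₁` of Gaussian class
with `∫ x_i e_j = δ_ij`. [folklore] -/
theorem arnold_exists_momentBasis :
    ∃ e₀ e₁ : EuclideanSpace ℝ (Fin 2) → ℝ, Continuous e₀ ∧ Continuous e₁ ∧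
      (∀ x, e₀ (-x) = -e₀ x) ∧ (∀ x, e₁ (-x) = -e₁ x) ∧
      (∃ (C : ℝ) (N : ℕ), ∀ x, |e₀ x| ≤ C * (1 + ‖x‖) ^ N * Real.exp (-(‖x‖ ^ 2 / 4))) ∧
      (∃ (C : ℝ) (N : ℕ), ∀ x, |e₁ x| ≤ C * (1 + ‖x‖) ^ N * Real.exp (-(‖x‖ ^ 2 / 4))) ∧
      ∫ x, x 0 * e₀ x = 1 ∧ ∫ x, x 1 * e₀ x = 0 ∧ ∫ x, x 0 * e₁ x = 0 ∧ ∫ x, x 1 * e₁ x = 1 := by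
  set κ : ℝ := ∫ x : EuclideanSpace ℝ (Fin 2), x 0 ^ 2 * Real.exp (-(‖x‖ ^ 2 / 4)) with hκ
  have hκ0 : 0 < κ := arnold_kappa_pos
  have hgc : ∀ j : Fin 2, ∃ (C : ℝ) (N : ℕ), ∀ x : EuclideanSpace ℝ (Fin 2),
      |κ⁻¹ * (x j * Real.exp (-(‖x‖ ^ 2 / 4)))| ≤ C * (1 + ‖x‖) ^ N * Real.exp (-(‖x‖ ^ 2 / 4)) := by
    intro j
    refine ⟨κ⁻¹, 1, fun x => ?_⟩
    rw [abs_mul, abs_of_pos (inv_pos.2 hκ0), abs_mul, abs_of_pos (Real.exp_pos _), pow_one, mul_assoc]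
    refine mul_le_mul_of_nonneg_left (mul_le_mul_of_nonneg_right ?_ (Real.exp_pos _).le)
      (inv_pos.2 hκ0).le
    have : |x j| ≤ ‖x‖ := by simpa using PiLp.norm_apply_le x j
    linarith
  have hodd : ∀ (j : Fin 2) (x : EuclideanSpace ℝ (Fin 2)),
      κ⁻¹ * ((-x) j * Real.exp (-(‖-x‖ ^ 2 / 4))) = -(κ⁻¹ * (x j * Real.exp (-(‖x‖ ^ 2 / 4)))) := by
    intro j x
    rw [PiLp.neg_apply, norm_neg]; ring
  have hcont : ∀ j : Fin 2, Continuous fun x : EuclideanSpace ℝ (Fin 2) =>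
      κ⁻¹ * (x j * Real.exp (-(‖x‖ ^ 2 / 4))) := fun j => by fun_prop
  -- the moment matrix
  have hm : ∀ i j : Fin 2, ∫ x : EuclideanSpace ℝ (Fin 2), x i * (κ⁻¹ * (x j * Real.exp (-(‖x‖ ^ 2 / 4)))) =
      κ⁻¹ * ∫ x : EuclideanSpace ℝ (Fin 2), x i * x j * Real.exp (-(‖x‖ ^ 2 / 4)) := by
    intro i j
    rw [← integral_const_mul]
    exact integral_congr_ae (Eventually.of_forall fun x => by simp only; ring)
  have h00 : ∫ x : EuclideanSpace ℝ (Fin 2), x 0 * x 0 * Real.exp (-(‖x‖ ^ 2 / 4)) = κ := by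
    rw [hκ]; exact integral_congr_ae (Eventually.of_forall fun x => by simp only; ring)
  have h11 : ∫ x : EuclideanSpace ℝ (Fin 2), x 1 * x 1 * Real.exp (-(‖x‖ ^ 2 / 4)) = κ := by
    rw [hκ, ← arnold_integral_sq_one_eq]
    exact integral_congr_ae (Eventually.of_forall fun x => by simp only; ring)
  have h01 : ∫ x : EuclideanSpace ℝ (Fin 2), x 0 * x 1 * Real.exp (-(‖x‖ ^ 2 / 4)) = 0 :=
    arnold_integral_zero_mul_one_eq_zero
  have h10 : ∫ x : EuclideanSpace ℝ (Fin 2), x 1 * x 0 * Real.exp (-(‖x‖ ^ 2 / 4)) = 0 := by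
    rw [← h01]; exact integral_congr_ae (Eventually.of_forall fun x => by simp only; ring)
  refine ⟨fun x => κ⁻¹ * (x 0 * Real.exp (-(‖x‖ ^ 2 / 4))),
    fun x => κ⁻¹ * (x 1 * Real.exp (-(‖x‖ ^ 2 / 4))), hcont 0, hcont 1, hodd 0, hodd 1, hgc 0, hgc 1,
    ?_, ?_, ?_, ?_⟩
  · rw [hm, h00, inv_mul_cancel₀ hκ0.ne']
  · rw [hm, h10, mul_zero]
  · rw [hm, h01, mul_zero]
  · rw [hm, h11, inv_mul_cancel₀ hκ0.ne']

/-! ### Continuity of the potential of a test density -/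

/-- A continuous compactly supported field obeys a pure Gaussian bound `‖f‖ ≤ B e^{−‖x‖²/8}`. [folklore] -/
theorem arnold_gaussBound_of_hasCompactSupport {F : Type*} [NormedAddCommGroup F]
    {f : EuclideanSpace ℝ (Fin 2) → F} (hf : Continuous f) (hs : HasCompactSupport f) :
    ∃ B : ℝ, 0 ≤ B ∧ ∀ x, ‖f x‖ ≤ B * Real.exp (-(1 / 8) * ‖x‖ ^ 2) := by
  obtain ⟨M, hM⟩ := hf.bounded_above_of_compact_support hs
  obtain ⟨R, hR⟩ := hs.isCompact.isBounded.subset_closedBall 0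
  have hM0 : 0 ≤ M := (norm_nonneg _).trans (hM 0)
  refine ⟨M * Real.exp (R ^ 2 / 8), by positivity, fun x => ?_⟩
  by_cases hx : x ∈ tsupport f
  · have hxR : ‖x‖ ≤ R := by simpa using hR hx
    have h1 : 1 ≤ Real.exp (R ^ 2 / 8) * Real.exp (-(1 / 8) * ‖x‖ ^ 2) := by
      rw [← Real.exp_add]
      exact Real.one_le_exp (by nlinarith [norm_nonneg x])
    calc ‖f x‖ ≤ M * 1 := by rw [mul_one]; exact hM x
      _ ≤ M * (Real.exp (R ^ 2 / 8) * Real.exp (-(1 / 8) * ‖x‖ ^ 2)) :=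
          mul_le_mul_of_nonneg_left h1 hM0
      _ = _ := by ring
  · rw [image_eq_zero_of_notMem_tsupport hx, norm_zero]
    positivity

/-- **Continuity of `ψ_w` for a compactly supported `C¹` density** (tree:
`contDiff_one_logPotential_of_gaussBound`). [folklore] -/
theorem arnold_continuous_logPotential {w : EuclideanSpace ℝ (Fin 2) → ℝ} (hw : ContDiff ℝ 1 w)
    (hws : HasCompactSupport w) :
    Continuous fun x : EuclideanSpace ℝ (Fin 2) => ∫ y, (2 * Real.pi)⁻¹ * Real.log ‖x - y‖ * w y := by
  obtain ⟨B₁, hB₁, h₁⟩ := arnold_gaussBound_of_hasCompactSupport hw.continuous hws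
  obtain ⟨B₂, hB₂, h₂⟩ := arnold_gaussBound_of_hasCompactSupport (hw.continuous_fderiv one_ne_zero)
    (hws.fderiv (𝕜 := ℝ))
  have hg0 : ∀ η, |w η| ≤ max B₁ B₂ * Real.exp (-(1 / 8) * ‖η‖ ^ 2) := fun η => by
    rw [← Real.norm_eq_abs]
    exact (h₁ η).trans (mul_le_mul_of_nonneg_right (le_max_left _ _) (Real.exp_pos _).le)
  have hg1 : ∀ η, ‖fderiv ℝ w η‖ ≤ max B₁ B₂ * Real.exp (-(1 / 8) * ‖η‖ ^ 2) := fun η =>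
    (h₂ η).trans (mul_le_mul_of_nonneg_right (le_max_right _ _) (Real.exp_pos _).le)
  exact (contDiff_one_logPotential_of_gaussBound hw hg0 hg1).1.continuous

/-! ### Weighted `L²` norms: Minkowski and scaling -/

section Weighted

variable {α : Type*} [MeasurableSpace α] {μ : Measure α}

/-- **Weighted Minkowski inequality**: `√∫ g (a+b)² ≤ √∫ g a² + √∫ g b²` for a weight `g ≥ 0`
with `g a², g b² ∈ L¹` (from the weighted Cauchy–Schwarz inequality
`abs_integral_weight_mul_mul_le`), together with `g (a+b)² ∈ L¹`. [folklore] -/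
theorem arnold_sqrt_integral_weight_mul_add_sq_le {g a b : α → ℝ} (hg : ∀ x, 0 ≤ g x)
    (hgm : AEStronglyMeasurable g μ) (ham : AEStronglyMeasurable a μ)
    (hbm : AEStronglyMeasurable b μ) (ha : Integrable (fun x => g x * a x ^ 2) μ)
    (hb : Integrable (fun x => g x * b x ^ 2) μ) :
    Integrable (fun x => g x * (a x + b x) ^ 2) μ ∧
      Real.sqrt (∫ x, g x * (a x + b x) ^ 2 ∂μ) ≤
        Real.sqrt (∫ x, g x * a x ^ 2 ∂μ) + Real.sqrt (∫ x, g x * b x ^ 2 ∂μ) := by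
  obtain ⟨hab, hcs⟩ := abs_integral_weight_mul_mul_le hg hgm ham hbm ha hb
  have hA : 0 ≤ ∫ x, g x * a x ^ 2 ∂μ := integral_nonneg fun x => mul_nonneg (hg x) (sq_nonneg _)
  have hB : 0 ≤ ∫ x, g x * b x ^ 2 ∂μ := integral_nonneg fun x => mul_nonneg (hg x) (sq_nonneg _)
  have e : (fun x => g x * (a x + b x) ^ 2) =
      fun x => (g x * a x ^ 2 + 2 * (g x * (a x * b x))) + g x * b x ^ 2 := by
    funext x; ring
  have h2 : Integrable (fun x => 2 * (g x * (a x * b x))) μ := hab.const_mul 2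
  have h1 : Integrable (fun x => g x * a x ^ 2 + 2 * (g x * (a x * b x))) μ := ha.add h2
  have hint : Integrable (fun x => g x * (a x + b x) ^ 2) μ := by rw [e]; exact h1.add hb
  refine ⟨hint, ?_⟩
  have hexp : ∫ x, g x * (a x + b x) ^ 2 ∂μ =
      (∫ x, g x * a x ^ 2 ∂μ) + 2 * (∫ x, g x * (a x * b x) ∂μ) + ∫ x, g x * b x ^ 2 ∂μ := by
    rw [e, integral_add h1 hb, integral_add ha h2, integral_const_mul]
  have hle : ∫ x, g x * (a x + b x) ^ 2 ∂μ ≤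
      (Real.sqrt (∫ x, g x * a x ^ 2 ∂μ) + Real.sqrt (∫ x, g x * b x ^ 2 ∂μ)) ^ 2 := by
    rw [hexp, add_sq, Real.sq_sqrt hA, Real.sq_sqrt hB]
    have := (abs_le.1 hcs).2
    nlinarith
  calc Real.sqrt (∫ x, g x * (a x + b x) ^ 2 ∂μ)
      ≤ Real.sqrt ((Real.sqrt (∫ x, g x * a x ^ 2 ∂μ) + Real.sqrt (∫ x, g x * b x ^ 2 ∂μ)) ^ 2) :=
        Real.sqrt_le_sqrt hle
    _ = Real.sqrt (∫ x, g x * a x ^ 2 ∂μ) + Real.sqrt (∫ x, g x * b x ^ 2 ∂μ) :=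
        Real.sqrt_sq (add_nonneg (Real.sqrt_nonneg _) (Real.sqrt_nonneg _))

/-- Three-term weighted Minkowski inequality. [folklore] -/
theorem arnold_sqrt_integral_weight_mul_add_add_sq_le {g a b c : α → ℝ} (hg : ∀ x, 0 ≤ g x)
    (hgm : AEStronglyMeasurable g μ) (ham : AEStronglyMeasurable a μ)
    (hbm : AEStronglyMeasurable b μ) (hcm : AEStronglyMeasurable c μ)
    (ha : Integrable (fun x => g x * a x ^ 2) μ) (hb : Integrable (fun x => g x * b x ^ 2) μ)
    (hc : Integrable (fun x => g x * c x ^ 2) μ) :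
    Integrable (fun x => g x * (a x + b x + c x) ^ 2) μ ∧
      Real.sqrt (∫ x, g x * (a x + b x + c x) ^ 2 ∂μ) ≤
        Real.sqrt (∫ x, g x * a x ^ 2 ∂μ) + Real.sqrt (∫ x, g x * b x ^ 2 ∂μ) +
          Real.sqrt (∫ x, g x * c x ^ 2 ∂μ) := by
  obtain ⟨hab, h1⟩ := arnold_sqrt_integral_weight_mul_add_sq_le hg hgm ham hbm ha hb
  obtain ⟨habc, h2⟩ := arnold_sqrt_integral_weight_mul_add_sq_le (a := fun x => a x + b x) hg hgm
    (ham.add hbm) hcm hab hc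
  exact ⟨habc, h2.trans (by linarith)⟩

/-- Scaling of a weighted `L²` norm: `√∫ g (c a)² = |c| √∫ g a²`. [folklore] -/
theorem arnold_sqrt_integral_weight_mul_const_mul_sq (g a : α → ℝ) (c : ℝ) :
    Real.sqrt (∫ x, g x * (c * a x) ^ 2 ∂μ) = |c| * Real.sqrt (∫ x, g x * a x ^ 2 ∂μ) := by
  have e : (fun x => g x * (c * a x) ^ 2) = fun x => c ^ 2 * (g x * a x ^ 2) := by
    funext x; ring
  rw [e, integral_const_mul, Real.sqrt_mul (sq_nonneg c), Real.sqrt_sq_eq_abs]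

/-- Monotonicity of weighted `L²` norms in the weight: `g₁ ≤ K g₂` pointwise (`g₁ ≥ 0`) gives
`√∫ g₁ a² ≤ √K √∫ g₂ a²` when `g₂ a² ∈ L¹`. [folklore] -/
theorem arnold_sqrt_integral_weight_mul_sq_le_of_le {g₁ g₂ a : α → ℝ} {K : ℝ} (hK : 0 ≤ K)
    (hg₁ : ∀ x, 0 ≤ g₁ x) (hle : ∀ x, g₁ x ≤ K * g₂ x)
    (h2 : Integrable (fun x => g₂ x * a x ^ 2) μ) :
    Real.sqrt (∫ x, g₁ x * a x ^ 2 ∂μ) ≤ Real.sqrt K * Real.sqrt (∫ x, g₂ x * a x ^ 2 ∂μ) := by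
  rw [← Real.sqrt_mul hK, ← integral_const_mul]
  refine Real.sqrt_le_sqrt (integral_mono_of_nonneg
    (Eventually.of_forall fun x => mul_nonneg (hg₁ x) (sq_nonneg _)) (h2.const_mul K)
    (Eventually.of_forall fun x => ?_))
  have := mul_le_mul_of_nonneg_right (hle x) (sq_nonneg (a x))
  simpa only [mul_assoc] using this

end Weighted

/-! ### The registered tools stub -/

/-- **Registered tools stub `stub_oddArnoldToolsC`** (helpers for `stub_oddSymmetrizerBoundedBelow`, line
`Sketch` of crux `CoreLinearInvertibility`, stmt-NavierStokesRegularity-17973): the odd Gaussian-class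
moment basis `e₀, e₁` with `∫ x_i e_j = δ_ij`, continuity of the logarithmic potential of a compactly
supported `C¹` density, and the weighted Minkowski inequality. [folklore] -/
theorem stub_oddArnoldToolsC :
    (∃ e₀ e₁ : EuclideanSpace ℝ (Fin 2) → ℝ, Continuous e₀ ∧ Continuous e₁ ∧
      (∀ x, e₀ (-x) = -e₀ x) ∧ (∀ x, e₁ (-x) = -e₁ x) ∧
      (∃ (C : ℝ) (N : ℕ), ∀ x, |e₀ x| ≤ C * (1 + ‖x‖) ^ N * Real.exp (-(‖x‖ ^ 2 / 4))) ∧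
      (∃ (C : ℝ) (N : ℕ), ∀ x, |e₁ x| ≤ C * (1 + ‖x‖) ^ N * Real.exp (-(‖x‖ ^ 2 / 4))) ∧
      ∫ x, x 0 * e₀ x = 1 ∧ ∫ x, x 1 * e₀ x = 0 ∧ ∫ x, x 0 * e₁ x = 0 ∧ ∫ x, x 1 * e₁ x = 1) ∧
    (∀ w : EuclideanSpace ℝ (Fin 2) → ℝ, ContDiff ℝ 1 w → HasCompactSupport w →
      Continuous fun x : EuclideanSpace ℝ (Fin 2) => ∫ y, (2 * Real.pi)⁻¹ * Real.log ‖x - y‖ * w y) ∧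
    (∀ g a b : EuclideanSpace ℝ (Fin 2) → ℝ, (∀ x, 0 ≤ g x) → AEStronglyMeasurable g volume →
      AEStronglyMeasurable a volume → AEStronglyMeasurable b volume →
      Integrable (fun x => g x * a x ^ 2) → Integrable (fun x => g x * b x ^ 2) →
      Real.sqrt (∫ x, g x * (a x + b x) ^ 2) ≤
        Real.sqrt (∫ x, g x * a x ^ 2) + Real.sqrt (∫ x, g x * b x ^ 2)) :=
  ⟨arnold_exists_momentBasis, fun _ hw hws => arnold_continuous_logPotential hw hws,
    fun _ _ _ hg hgm ham hbm ha hb =>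
      (arnold_sqrt_integral_weight_mul_add_sq_le (μ := volume) hg hgm ham hbm ha hb).2⟩

end Summit.NavierStokesRegularity.NavierStokesRegularity.Theorems
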